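import Literature.MathematicalPhysics.QuantumFieldTheory.Balaban1983to89.B9Eq326ConjugatedDeltaALetters
import Literature.MathematicalPhysics.QuantumFieldTheory.Balaban1983to89.B9Eq386GreenLipschitzEnergy

/-!
# `Balaban1983to89.B9Eq326ConjugatedDeltaAEnergyWeight` — T. Bałaban, *Propagators for lattice gauge theories in a background field*, Commun. Math. Phys.
# **99** (1985) 389–434 [Balaban1985BackgroundPropagators] (3.26) p. 395, (3.21) p. 394, (3.49) p. 399, Thm 3.4 p. 400, (3.84)–(3.86) p. 407, Thm 3.11
# p. 416 with [Balaban1985Variational] (110) p. 294: **THE CONJUGATED `Δ_a`-SHAPED OPERATOR IS STRONGLY COERCIVE IN THE COVARIANT ENERGY WEIGHT —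
# `¼(‖B₁f‖² + ‖R(B₂f)‖² + a‖Qf‖²) + (γ∕8)‖f‖² ≤ re⟪f, H_κf⟫` (the three half-squares of `B9Eq326ConjugatedDeltaALetters.coercive_k_projected` KEPT instead
# of spent), HENCE THE TWO-BACKGROUND DIFFERENCE OF TWO RIGHT INVERSES `‖G_κ(V)y − G_κ(U)y‖ ≤ (Θ_κ∕γ′)·C₀·‖y‖` FROM A FORM DEFECT ALONE**
# (`B9Eq386GreenLipschitzEnergy` §2 on the CONJUGATED pair) — abstract finite-dimensional `𝕜`-Hilbert letters; the energy-currency twin of (CDA)'s `‖G_κ‖ ≤ 4∕γ`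

statement-level skeleton of published theorems with citation tags; proofs where landed; nothing here is a claim about the Yang–Mills mass gap

CITATION HEADER (lean-in-tree rule).  Audit cell `pub-balaban`, sub-cell `t4`, BINDER row NE9; filed by NE9 formalisation-swarm LEAF PROVER 01
(`b2b-balaban-t4-ne9-formalise-leaf-01`, gen 88) under the fallback offer O-leaf01-g88-1 on the crux-ideation seat t4-ne9-idea-1 gen 151's located note N52
(«the two-background difference of the bond propagator WITH decay», road (α); cell journal 2026-08-25 l.62985).  CREDIT: the mechanism and the Lean text of
§1, §2 (`norm_le_weightU`, `coerciveN_k`), §3 and §4 are t4-ne9-idea-1 g151's scratch kernel `NE9TwoBackgroundDecay` (e5702a1273347033, NOT-TO-FILE under the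
cell's FREEZE (0)), ported here token for token up to the positivity binders of §4, which this file DISCHARGES from the coercivity (§2 `re_inner_pos_of_coerciveN`).
Imports (CDA) `B9Eq326ConjugatedDeltaALetters` (ne9-leaf-03 gen 75: `re_inner_projected_perturbed`, `re_inner_H_eq`, `coercive_k_projected`) and the NE9 owner's
`B9Eq386GreenLipschitzEnergy` (gen 86: `weight_green_le`, `norm_green_sub_le_of_bound`).  Sources READ first-hand in the held text layer
(`paper:balaban1985-cmp99-background-propagators`, journal page = PDF page + 388): p. 395 (3.26) *«Δ_a(U) = Δ(U) + D_UR(U)D*_U + Q*(U)aQ(U)»*, p. 394 (3.21)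
*«R = R(U) is an orthogonal projection»*, p. 399 (3.49) (the exponential weights), p. 400 Thm 3.4 *«extend to configurations U′U … as analytic functions of A
… we prove quantitative statements which are more precise, describing these analytic extensions as small perturbations of the operators depending on U only»*,
p. 407 (3.86) *«G(U′U) = G(U)(I − V(A)G(U))⁻¹»*, p. 416 Thm 3.11 *«the operators … Δ_a, G are positive, uniformly bounded from below … the kernels … decay
exponentially»*; [Balaban1985Variational] p. 294 *«We denote by G₁ an inverse operator to the operator Δ₁ + DRD* + aQ*Q.»*  Print's perturbation in the
background is the Neumann series (3.86) and its decay proof is the random walk of Sect. C; the conjugation `e^{κχ}(·)e^{−κχ}` and the energy-norm perturbation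
argument are the ROUTE's substitutes (`t4/ROUTES-NE9.md` §L1.2 R2′, road B8″; §L1.4 EXAMINED gen 151, N52); nothing of print's rate or radius is asserted.

WHY THIS FILE (cell context, N52 §1–§2).  The tree has ONE-background DECAY of the conjugated bond propagator ((CDT) `B9Eq326ConjugatedDeltaATower.norm_conjG1k_le`:
`‖S∘G₁,k(U)∘S⁻¹‖ ≤ 4∕γ` from (CDA) `coercive_k_projected`, read out to block decay by `B9Eq349BondBlockDecayFromCircle`) and TWO-background rows WITHOUT decay
(ne9-leaf-04's `B9Eq386GreenkLipschitzEnergy(Pi)TwoBackgrounds`: energy currency, HONEST «NO kernel bound, NO decay»), and no file joining the two.  Road (α):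
`S(G₁,k(V) − G₁,k(U))S⁻¹ = G_κ(V) − G_κ(U)` with `G_κ(X) := S∘G₁,k(X)∘S⁻¹` a right inverse of `H_κ(X) := S∘Δ_{a,k}(X)∘S⁻¹` ((CDT) `conjDeltaAk_conjInv`), and
`B9Eq386GreenLipschitzEnergy.norm_green_sub_le_of_bound` applies VERBATIM to the conjugated pair `(H_κ(U), H_κ(V))` as soon as (A) `H_κ(U)` is STRONGLY coercive
in a weight `N_U` carrying the covariant squares — §1∕§2 here, the one new inequality — (B) the conjugated two-background FORM defect `|⟪u,(H_κ(V) − H_κ(U))v⟫|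
≤ Θ_κN_U(u)N_U(v)` is supplied (the sequel `B9Eq326ConjugatedDeltaATwoBackgrounds`, from letters), (C) the rows `N_U(G_κ(V)y) ≤ C₀‖y‖` hold (§4
`row_of_coercive`).  Uniformly over the Combes–Thomas circle `‖κ‖ = r` the output is the `hC` letter of `B9Eq349BondBlockDecayFromCircle.
norm_bondBlock_le_exp_of_uniform_circle_bound` for `T := G₁,k(V) − G₁,k(U)`: block decay of the two-background difference with a constant `∝ δ`.

WHAT IS PROVED (sorry-free; proof lane — no `def`; [folklore] finite-dimensional Hilbert-space algebra).  Letters of (CDA) §2: spaces `E` (bond fields),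
`P` (plaquettes), `S` (sites), `F` (blocks); `H f = B₁†(B₁f) + B₂†(R(B₂f)) + Kf + a•Q†(Qf)` with `re⟪s, Rs⟫ = ‖Rs‖²`, `‖Rs‖ ≤ ‖s‖`; the conjugated family
`H_κ f = B′_{1,κ}(B_{1,κ}f) + B′_{2,κ}(R_κ(B_{2,κ}f)) + K_κf + a•Q′_κ(Q_κf)` with the closeness letters `β, ρ, β_K`, the floor `p_K`, the complementary bound `C_P`.
* §1 **`coercive_k_projected_energy`** — on the window `¾p_K + (21 + 3a)β² + 4βC_P + 2ρC_P² + β_K ≤ γ∕8` (`ρ ≤ 1∕8`):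
  `¼(‖B₁f‖² + ‖R(B₂f)‖² + a‖Qf‖²) + (γ∕8)‖f‖² ≤ re⟪f, H_κf⟫`.
* §2 the covariant energy weight `N_U(f) := √(‖B₁f‖² + ‖R(B₂f)‖² + a‖Qf‖² + ‖f‖²)` (a TERM, no `def`): `weightU_nonneg`, **`norm_le_weightU`**, `norm_B₁_le_weightU`,
  `norm_RB₂_le_weightU`, `sqrt_mul_norm_Q_le_weightU`; **`coerciveN_k`** (`min(¼, γ∕8)·N_U(f)² ≤ re⟪f, H_κf⟫` — the `hcoerN` binder of
  `B9Eq386GreenLipschitzEnergy.weight_green_sub_le` for the CONJUGATED operator); **`re_inner_pos_of_coerciveN`** (`x ≠ 0 ⟹ 0 < re⟪x, H_κx⟫` — the `hpos`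
  binder of `B11Eq103H1Complex.greenK`, DERIVED).
* §3 **`rightInv_eq_greenK`** — `H_κ(Gv) = v ∀v ⟹ G = greenK H_κ hpos`: a right inverse of an operator with positive real part IS its Green operator.
* §4 **`norm_rightInv_sub_rightInv_le`** — for right inverses `G_U, G_V` of `T_U, T_V`: strong coercivity `γ′` of `T_U` in a weight `N ≥ ‖·‖`, a form defect
  `‖⟪u, T_Uv⟫ − ⟪u, T_Vv⟫‖ ≤ ΘN(u)N(v)` and rows `N(G_Vy) ≤ C₀‖y‖` give `‖G_Vy − G_Uy‖ ≤ (Θ∕γ′)·C₀·‖y‖` (positivity of `T_U`, `T_V` derived from their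
  coercivities); **`row_of_coercive`** — `N(G_Vy) ≤ (1 + δ_N)·γ_V⁻¹·‖y‖` from `T_V`'s coercivity `γ_V` in ITS weight `N_V ≥ ‖·‖` and `N ≤ (1 + δ_N)·N_V`; both together
  **`norm_rightInv_sub_rightInv_le_of_coercive`**.
MODEL ∕ HONEST SCOPE.  (M1) abstract letters, `𝕜 = ℝ` or `ℂ`; every space finite-dimensional.  (M2) DISPLAYED: `γ` (Thm 3.11's coercivity of `Δ_a`, NOT proved in
the tree), `p_K`, `β`, `β_K`, `ρ`, `C_P`, `a ≥ 0`; in §4 the defect `Θ` and the comparison `δ_N` (their suppliers from primitive letters are the sequel's §2–§4).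
(M3) the energy window is `γ∕8` with `¾p_K` where (CDA)'s `L²` window is `γ∕4` with `p_K∕2` — the price of keeping the squares; `γ′ = min(¼, γ∕8)` is crude.
(M4) FIRST order in `V − U` only (road (α)); no analyticity, no Neumann series (3.86), no Cauchy estimate on the background pencil (road (β)); no lattice object,
no rate, no window evaluated; the lattice junction ((CDT)'s binders at `U` and at `V`, ne9-leaf-04's closeness letters, the conjugation of a LOCAL difference)
is NOT here.  NOT NE9 (cell pub-balaban: NE9 NOT PRINTED ∕ NOT PROVED; «NE9 ⇐ the named binders»; row WALLED ON A MODEL (O-NE9-1; #5 UNRULED); spine PROVED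
0∕9; rung (B)+1 on a finite T⁴ — NOT infinite volume, NOT mass gap, NOT BetaPertH, NOT Clay).  HONEST DEPENDENCY (cell line): continuum YM on T⁴ ⇐ BetaPertH ∧
nine spine estimates (0/9 proved); BetaPertH ⇐ (D1) ∧ (D4) ∧ CAP+tail; G-an2-4 gates asym, D1 and NE2/3/4.  NEW file; nothing modified.  Net new unproved facts: 0.
-/

noncomputable section

open scoped InnerProductSpace ComplexConjugate

namespace Literature.MathematicalPhysics.QuantumFieldTheory.Balaban1983to89.B9Eq326ConjugatedDeltaAEnergyWeight

open B9Eq349ConjugatedGreenLetters (re_inner_perturbed)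
open B9Eq326ConjugatedDeltaALetters (re_inner_projected_perturbed re_inner_H_eq)
open B11Eq103H1Complex (greenK apply_greenK greenK_apply)
open B9Eq386GreenLipschitzEnergy (weight_green_le norm_green_sub_le_of_bound)

variable {𝕜 : Type*} [RCLike 𝕜]
  {E : Type*} [NormedAddCommGroup E] [InnerProductSpace 𝕜 E] [FiniteDimensional 𝕜 E]
  {P : Type*} [NormedAddCommGroup P] [InnerProductSpace 𝕜 P] [FiniteDimensional 𝕜 P]
  {S : Type*} [NormedAddCommGroup S] [InnerProductSpace 𝕜 S] [FiniteDimensional 𝕜 S]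
  {F : Type*} [NormedAddCommGroup F] [InnerProductSpace 𝕜 F] [FiniteDimensional 𝕜 F]

omit [FiniteDimensional 𝕜 E] in
/-- `−‖x‖‖y‖ ≤ re⟪x, y⟫`. [folklore] [cite: Balaban1985BackgroundPropagators, (3.11) p.392] -/
private theorem neg_mul_norm_le_re_inner (x y : E) : -(‖x‖ * ‖y‖) ≤ RCLike.re ⟪x, y⟫_𝕜 := by
  have h1 := (abs_le.1 (RCLike.abs_re_le_norm ⟪x, y⟫_𝕜)).1
  have h2 := norm_inner_le_norm (𝕜 := 𝕜) x y
  linarith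

/-! ## §1 The energy-keeping conjugated coercivity -/

section Family

variable (B₁ : E →ₗ[𝕜] P) (B₂ : E →ₗ[𝕜] S) (R : S →ₗ[𝕜] S) (Q : E →ₗ[𝕜] F) (K H : E →ₗ[𝕜] E) (a γ β βK pK ρ CP : ℝ)
  (B₁k : E →ₗ[𝕜] P) (B₁k' : P →ₗ[𝕜] E) (B₂k : E →ₗ[𝕜] S) (B₂k' : S →ₗ[𝕜] E) (Rk : S →ₗ[𝕜] S) (Qk : E →ₗ[𝕜] F) (Qk' : F →ₗ[𝕜] E)
  (Kk Hk : E →ₗ[𝕜] E)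
  (ha : 0 ≤ a) (hγ : 0 < γ) (hβ : 0 ≤ β) (hρ : 0 ≤ ρ) (hCP : 0 ≤ CP)
  (hRsq : ∀ s, RCLike.re ⟪s, R s⟫_𝕜 = ‖R s‖ ^ 2) (hR1 : ∀ s, ‖R s‖ ≤ ‖s‖)
  (hH : ∀ f, H f = LinearMap.adjoint B₁ (B₁ f) + LinearMap.adjoint B₂ (R (B₂ f)) + K f + ((a : ℝ) : 𝕜) • LinearMap.adjoint Q (Q f))
  (coercive : ∀ f, γ * ‖f‖ ^ 2 ≤ RCLike.re ⟪f, H f⟫_𝕜)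
  (hKre : ∀ f, -(pK * ‖f‖ ^ 2) ≤ RCLike.re ⟪f, K f⟫_𝕜)
  (dB₁ : ∀ f, ‖B₁k f - B₁ f‖ ≤ β * ‖f‖) (dB₁' : ∀ p, ‖B₁k' p - LinearMap.adjoint B₁ p‖ ≤ β * ‖p‖)
  (dB₂ : ∀ f, ‖B₂k f - B₂ f‖ ≤ β * ‖f‖) (dB₂' : ∀ s, ‖B₂k' s - LinearMap.adjoint B₂ s‖ ≤ β * ‖s‖)
  (dR : ∀ s, ‖Rk s - R s‖ ≤ ρ * ‖s‖)
  (dQ : ∀ f, ‖Qk f - Q f‖ ≤ β * ‖f‖) (dQ' : ∀ g, ‖Qk' g - LinearMap.adjoint Q g‖ ≤ β * ‖g‖)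
  (dK : ∀ f, ‖Kk f - K f‖ ≤ βK * ‖f‖)
  (small' : 3 / 4 * pK + (21 + 3 * a) * β ^ 2 + 4 * β * CP + 2 * ρ * CP ^ 2 + βK ≤ γ / 8)
  (hHk : ∀ f, Hk f = B₁k' (B₁k f) + B₂k' (Rk (B₂k f)) + Kk f + ((a : ℝ) : 𝕜) • Qk' (Qk f))

include ha hβ hρ hCP hRsq hR1 hH coercive hKre dB₁ dB₁' dB₂ dB₂' dR dQ dQ' dK small' hHk in
/-- **ENERGY-KEEPING PERTURBED COERCIVITY** of `H_κ = B′_{1,κ}B_{1,κ} + B′_{2,κ}R_κB_{2,κ} + K_κ + aQ′_κQ_κ`: on the window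
`¾p_K + (21 + 3a)β² + 4βC_P + 2ρC_P² + β_K ≤ γ∕8` (`ρ ≤ 1∕8`),
`¼(‖B₁f‖² + ‖R(B₂f)‖² + a‖Qf‖²) + (γ∕8)‖f‖² ≤ re⟪f, H_κf⟫` — the three halves of (CDA)'s `coercive_k_projected` are `½X` up to their defects, with
`X = ‖B₁f‖² + ‖R(B₂f)‖² + a‖Qf‖² = re⟪f,Hf⟫ − re⟪f,Kf⟫`; keep `¼X` and spend the other `¼X + ¾re⟪f,Kf⟫ ≥ ¼γ‖f‖² − ¾p_K‖f‖²`. [folklore]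
(Lean text: t4-ne9-idea-1 g151, kernel N52 §1.) [cite: Balaban1985BackgroundPropagators, (3.26) p.395, (3.21) p.394, (3.49) p.399, Thm 3.11 p.416; Balaban1985Variational, (110) p.294] -/
theorem coercive_k_projected_energy (hρ8 : ρ ≤ 1 / 8) (hP : ∀ f, ‖B₂ f - R (B₂ f)‖ ≤ CP * ‖f‖) (f : E) :
    1 / 4 * (‖B₁ f‖ ^ 2 + ‖R (B₂ f)‖ ^ 2 + a * ‖Q f‖ ^ 2) + γ / 8 * ‖f‖ ^ 2 ≤ RCLike.re ⟪f, Hk f⟫_𝕜 := by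
  have pK' : RCLike.re ⟪f, K f⟫_𝕜 - βK * ‖f‖ ^ 2 ≤ RCLike.re ⟪f, Kk f⟫_𝕜 := by
    have e : ⟪f, Kk f⟫_𝕜 = ⟪f, K f⟫_𝕜 + ⟪f, Kk f - K f⟫_𝕜 := by rw [← inner_add_right, add_sub_cancel]
    rw [e, map_add]
    have h1 := neg_mul_norm_le_re_inner (𝕜 := 𝕜) f (Kk f - K f)
    have h2 : ‖f‖ * ‖Kk f - K f‖ ≤ ‖f‖ * (βK * ‖f‖) := mul_le_mul_of_nonneg_left (dK f) (norm_nonneg _)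
    nlinarith [h1, h2]
  have e : RCLike.re ⟪f, Hk f⟫_𝕜 = RCLike.re ⟪f, B₁k' (B₁k f)⟫_𝕜 + RCLike.re ⟪f, B₂k' (Rk (B₂k f))⟫_𝕜 + RCLike.re ⟪f, Kk f⟫_𝕜 +
      a * RCLike.re ⟪f, Qk' (Qk f)⟫_𝕜 := by
    rw [hHk, inner_add_right, inner_add_right, inner_add_right, map_add, map_add, map_add, inner_smul_real_right, RCLike.smul_re]
  have e0 := re_inner_H_eq B₁ B₂ R Q K H a hRsq hH f
  have p1 := re_inner_perturbed B₁ B₁k B₁k' hβ dB₁ dB₁' f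
  have p2 := re_inner_projected_perturbed B₂ R B₂k B₂k' Rk hβ hρ hρ8 hCP hRsq hR1 dB₂ dB₂' dR hP f
  have pQ := mul_le_mul_of_nonneg_left (re_inner_perturbed Q Qk Qk' hβ dQ dQ' f) ha
  have sm := mul_le_mul_of_nonneg_right small' (sq_nonneg ‖f‖)
  have co := coercive f
  have hk := hKre f
  have hq : 0 ≤ a * ‖Q f‖ ^ 2 := by positivity
  nlinarith [e, e0, p1, p2, pQ, pK', sm, co, hk, hq]

/-! ## §2 The covariant energy weight `N_U(f)² = ‖B₁f‖² + ‖R(B₂f)‖² + a‖Qf‖² + ‖f‖²` -/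

omit [FiniteDimensional 𝕜 E] [FiniteDimensional 𝕜 P] [FiniteDimensional 𝕜 S] [FiniteDimensional 𝕜 F] in
/-- `0 ≤ N_U(f)`. [folklore] [cite: Balaban1985BackgroundPropagators, (3.26) p.395] -/
theorem weightU_nonneg (f : E) : 0 ≤ Real.sqrt (‖B₁ f‖ ^ 2 + ‖R (B₂ f)‖ ^ 2 + a * ‖Q f‖ ^ 2 + ‖f‖ ^ 2) := Real.sqrt_nonneg _

omit [FiniteDimensional 𝕜 E] [FiniteDimensional 𝕜 P] [FiniteDimensional 𝕜 S] [FiniteDimensional 𝕜 F] in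
include ha in
/-- **`‖f‖ ≤ N_U(f)`** — the weight dominates the norm (the `hNn` binder of `B9Eq386GreenLipschitzEnergy` §2). [folklore]
[cite: Balaban1985BackgroundPropagators, (3.26) p.395, Thm 3.4 p.400] -/
theorem norm_le_weightU (f : E) : ‖f‖ ≤ Real.sqrt (‖B₁ f‖ ^ 2 + ‖R (B₂ f)‖ ^ 2 + a * ‖Q f‖ ^ 2 + ‖f‖ ^ 2) := by
  apply Real.le_sqrt_of_sq_le
  have : 0 ≤ a * ‖Q f‖ ^ 2 := by positivity
  nlinarith [sq_nonneg ‖B₁ f‖, sq_nonneg ‖R (B₂ f)‖]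

omit [FiniteDimensional 𝕜 E] [FiniteDimensional 𝕜 P] [FiniteDimensional 𝕜 S] [FiniteDimensional 𝕜 F] in
include ha in
/-- `‖B₁f‖ ≤ N_U(f)` (the covariant curl is a component of the weight). [folklore] [cite: Balaban1985BackgroundPropagators, (3.26) p.395, (3.4) p.391] -/
theorem norm_B₁_le_weightU (f : E) : ‖B₁ f‖ ≤ Real.sqrt (‖B₁ f‖ ^ 2 + ‖R (B₂ f)‖ ^ 2 + a * ‖Q f‖ ^ 2 + ‖f‖ ^ 2) := by
  apply Real.le_sqrt_of_sq_le
  have : 0 ≤ a * ‖Q f‖ ^ 2 := by positivity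
  nlinarith [sq_nonneg ‖f‖, sq_nonneg ‖R (B₂ f)‖]

omit [FiniteDimensional 𝕜 E] [FiniteDimensional 𝕜 P] [FiniteDimensional 𝕜 S] [FiniteDimensional 𝕜 F] in
include ha in
/-- `‖R(B₂f)‖ ≤ N_U(f)` (the projected covariant divergence is a component of the weight). [folklore] [cite: Balaban1985BackgroundPropagators, (3.26) p.395, (3.21) p.394] -/
theorem norm_RB₂_le_weightU (f : E) : ‖R (B₂ f)‖ ≤ Real.sqrt (‖B₁ f‖ ^ 2 + ‖R (B₂ f)‖ ^ 2 + a * ‖Q f‖ ^ 2 + ‖f‖ ^ 2) := by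
  apply Real.le_sqrt_of_sq_le
  have : 0 ≤ a * ‖Q f‖ ^ 2 := by positivity
  nlinarith [sq_nonneg ‖f‖, sq_nonneg ‖B₁ f‖]

omit [FiniteDimensional 𝕜 E] [FiniteDimensional 𝕜 P] [FiniteDimensional 𝕜 S] [FiniteDimensional 𝕜 F] in
include ha in
/-- `√a·‖Qf‖ ≤ N_U(f)` (the averaging enters the weight with its coupling `a ≥ 0`). [folklore] [cite: Balaban1985BackgroundPropagators, (3.26) p.395, (3.15) p.393] -/
theorem sqrt_mul_norm_Q_le_weightU (f : E) : Real.sqrt a * ‖Q f‖ ≤ Real.sqrt (‖B₁ f‖ ^ 2 + ‖R (B₂ f)‖ ^ 2 + a * ‖Q f‖ ^ 2 + ‖f‖ ^ 2) := by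
  apply Real.le_sqrt_of_sq_le
  rw [mul_pow, Real.sq_sqrt ha]
  nlinarith [sq_nonneg ‖f‖, sq_nonneg ‖B₁ f‖, sq_nonneg ‖R (B₂ f)‖]

include ha hβ hρ hCP hRsq hR1 hH coercive hKre dB₁ dB₁' dB₂ dB₂' dR dQ dQ' dK small' hHk in
/-- **`H_κ(U)` IS STRONGLY COERCIVE IN THE COVARIANT ENERGY WEIGHT**: `min(¼, γ∕8)·N_U(f)² ≤ re⟪f, H_κf⟫` — the `hcoerN` binder of
`B9Eq386GreenLipschitzEnergy.weight_green_sub_le` for the CONJUGATED operator. [folklore] (Lean text: t4-ne9-idea-1 g151, kernel N52 §2.)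
[cite: Balaban1985BackgroundPropagators, (3.26) p.395, (3.49) p.399, Thm 3.4 p.400, Thm 3.11 p.416] -/
theorem coerciveN_k (hρ8 : ρ ≤ 1 / 8) (hP : ∀ f, ‖B₂ f - R (B₂ f)‖ ≤ CP * ‖f‖) (f : E) :
    min (1 / 4) (γ / 8) * Real.sqrt (‖B₁ f‖ ^ 2 + ‖R (B₂ f)‖ ^ 2 + a * ‖Q f‖ ^ 2 + ‖f‖ ^ 2) ^ 2 ≤ RCLike.re ⟪f, Hk f⟫_𝕜 := by
  have hX : 0 ≤ ‖B₁ f‖ ^ 2 + ‖R (B₂ f)‖ ^ 2 + a * ‖Q f‖ ^ 2 := by positivity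
  rw [Real.sq_sqrt (by positivity)]
  have h := coercive_k_projected_energy B₁ B₂ R Q K H a γ β βK pK ρ CP B₁k B₁k' B₂k B₂k' Rk Qk Qk' Kk Hk ha hβ hρ hCP hRsq hR1 hH coercive
    hKre dB₁ dB₁' dB₂ dB₂' dR dQ dQ' dK small' hHk hρ8 hP f
  have m1 : min (1 / 4) (γ / 8) ≤ 1 / 4 := min_le_left _ _
  have m2 : min (1 / 4) (γ / 8) ≤ γ / 8 := min_le_right _ _
  have hf : 0 ≤ ‖f‖ ^ 2 := sq_nonneg _
  rw [mul_add]
  nlinarith [mul_le_mul_of_nonneg_right m1 hX, mul_le_mul_of_nonneg_right m2 hf]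

end Family

omit [FiniteDimensional 𝕜 E] in
/-- **POSITIVITY FROM A STRONG COERCIVITY IN A DOMINATING WEIGHT**: `γ′N(z)² ≤ re⟪z, Tz⟫`, `‖z‖ ≤ N(z)`, `γ′ > 0` ⟹ `re⟪x, Tx⟫ > 0` for `x ≠ 0` — the `hpos`
binder of `B11Eq103H1Complex.greenK` for the conjugated operator, so that no positivity witness has to be displayed beside the coercivity. [folklore]
[cite: Balaban1985BackgroundPropagators, Thm 3.11 p.416; Balaban1985Variational, (110) p.294] -/
theorem re_inner_pos_of_coerciveN {T : E →ₗ[𝕜] E} (N : E → ℝ) (hNn : ∀ z, ‖z‖ ≤ N z) {γ' : ℝ} (hγ' : 0 < γ')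
    (hcoerN : ∀ z : E, γ' * N z ^ 2 ≤ RCLike.re ⟪z, T z⟫_𝕜) (x : E) (hx : x ≠ 0) : 0 < RCLike.re ⟪x, T x⟫_𝕜 := by
  have h1 : 0 < ‖x‖ := norm_pos_iff.mpr hx
  have h2 : ‖x‖ ^ 2 ≤ N x ^ 2 := pow_le_pow_left₀ (norm_nonneg _) (hNn x) 2
  have h3 : 0 < γ' * ‖x‖ ^ 2 := by positivity
  nlinarith [hcoerN x, mul_le_mul_of_nonneg_left h2 hγ'.le]

/-! ## §3 A right inverse of an operator with positive real part IS its Green operator -/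

/-- `H_κ(Gv) = v` for all `v` ⟹ `G = greenK H_κ` — so (CDT)'s `S∘G₁,k(U)∘S⁻¹`, a right inverse of `S∘Δ_{a,k}(U)∘S⁻¹` by
`B9Eq326ConjugatedDeltaATower.conjDeltaAk_conjInv`, IS `greenK` of the conjugated operator, and `B9Eq386GreenLipschitzEnergy` §2 applies to it. [folklore]
(Lean text: t4-ne9-idea-1 g151, kernel N52 §3.) [cite: Balaban1985Variational, (110) p.294; Balaban1985BackgroundPropagators, Thm 3.11 p.416] -/
theorem rightInv_eq_greenK {T G : E →ₗ[𝕜] E} (hpos : ∀ x : E, x ≠ 0 → 0 < RCLike.re ⟪x, T x⟫_𝕜) (hTG : ∀ v, T (G v) = v) (v : E) :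
    G v = greenK T hpos v := by
  conv_lhs => rw [← greenK_apply hpos (G v), hTG]

/-! ## §4 The assembly: the two-background difference of two right inverses from a form defect -/

section Assembly

variable {TU TV GU GV : E →ₗ[𝕜] E} (hGU : ∀ v, TU (GU v) = v) (hGV : ∀ v, TV (GV v) = v)
  (N : E → ℝ) (hN : ∀ w, 0 ≤ N w) (hNn : ∀ z, ‖z‖ ≤ N z) {γ' Θ C₀ : ℝ} (hγ' : 0 < γ') (hΘ : 0 ≤ Θ)
  (hcoerN : ∀ z : E, γ' * N z ^ 2 ≤ RCLike.re ⟪z, TU z⟫_𝕜)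
  (hT : ∀ u v : E, ‖⟪u, TU v⟫_𝕜 - ⟪u, TV v⟫_𝕜‖ ≤ Θ * N u * N v)
  (hrow : ∀ y : E, N (GV y) ≤ C₀ * ‖y‖)
  (NV : E → ℝ) (hNVn : ∀ z, ‖z‖ ≤ NV z) {γV : ℝ} (hγV : 0 < γV) (hcoerNV : ∀ z : E, γV * NV z ^ 2 ≤ RCLike.re ⟪z, TV z⟫_𝕜)

include hGU hGV hN hNn hγ' hΘ hcoerN hT hrow hNVn hγV hcoerNV in
/-- **`‖G_κ(V)y − G_κ(U)y‖ ≤ (Θ_κ∕γ′)·C₀·‖y‖`** for right inverses `G_κ(X)` of the conjugated operators `T_X = S∘Δ_a(X)∘S⁻¹` (`X = U, V`): strong coercivity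
`γ′` of `T_U` in a weight `N ≥ ‖·‖` (§2), a FORM DEFECT `‖⟪u, T_Uv⟫ − ⟪u, T_Vv⟫‖ ≤ Θ_κN(u)N(v)` (two-background + conjugation letters, `Θ_κ ∝ δ`), the rows
`N(G_κ(V)y) ≤ C₀‖y‖`, and SOME strong coercivity of `T_V` in a dominating weight `N_V` (used only for `T_V`'s positivity) —
`B9Eq386GreenLipschitzEnergy.norm_green_sub_le_of_bound` on the conjugated pair through §3.  Uniformly over the Combes–Thomas circle `‖κ‖ = r` and the pair
weights, this is the `hC` letter of `B9Eq349BondBlockDecayFromCircle.norm_bondBlock_le_exp_of_uniform_circle_bound` for `T := G₁(V) − G₁(U)`: BLOCK DECAY OF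
THE TWO-BACKGROUND DIFFERENCE with constant `∝ δ`. [folklore] (Lean text: t4-ne9-idea-1 g151, kernel N52 §4, positivity binders discharged.)
[cite: Balaban1985BackgroundPropagators, Thm 3.4 p.400, (3.84)–(3.86) p.407, (3.49) p.399, Thm 3.11 p.416] -/
theorem norm_rightInv_sub_rightInv_le (y : E) : ‖GV y - GU y‖ ≤ Θ / γ' * C₀ * ‖y‖ := by
  have hposU : ∀ x : E, x ≠ 0 → 0 < RCLike.re ⟪x, TU x⟫_𝕜 := re_inner_pos_of_coerciveN N hNn hγ' hcoerN
  have hposV : ∀ x : E, x ≠ 0 → 0 < RCLike.re ⟪x, TV x⟫_𝕜 := re_inner_pos_of_coerciveN NV hNVn hγV hcoerNV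
  have hV : GV y = greenK TV hposV y := rightInv_eq_greenK hposV hGV y
  have hU : GU y = greenK TU hposU y := rightInv_eq_greenK hposU hGU y
  have hrow' : ∀ y : E, N (greenK TV hposV y) ≤ C₀ * ‖y‖ := fun y => by rw [← rightInv_eq_greenK hposV hGV y]; exact hrow y
  rw [hV, hU]
  exact norm_green_sub_le_of_bound hposV hposU N hN hγ' hΘ hcoerN hT hNn hrow' y

include hGV hNVn hγV hcoerNV in
/-- **THE ROWS `C₀` FROM THE OTHER BACKGROUND's COERCIVITY AND A WEIGHT COMPARISON**: if `T_V` is `γ_V`-coercive in ITS weight `N_V ≥ ‖·‖` and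
`N(g) ≤ (1 + δ_N)·N_V(g)` (a MULTIPLICATIVE comparison — first-order two-background letters measured against `N_V`, so that at the lattice every letter is
zeroth order: the sequel's §3), then `N(G_κ(V)y) ≤ (1 + δ_N)·γ_V⁻¹·‖y‖` (`B9Eq386GreenLipschitzEnergy.weight_green_le` at `V`). [folklore]
(Lean text: t4-ne9-idea-1 g151, kernel N52 §4, comparison made multiplicative.) [cite: Balaban1985BackgroundPropagators, Thm 3.4 p.400, Thm 3.11 p.416] -/
theorem row_of_coercive (hNV : ∀ w, 0 ≤ NV w) {δN : ℝ} (hδN : 0 ≤ δN) (hcmp : ∀ g, N g ≤ (1 + δN) * NV g) (y : E) :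
    N (GV y) ≤ (1 + δN) * γV⁻¹ * ‖y‖ := by
  have hposV : ∀ x : E, x ≠ 0 → 0 < RCLike.re ⟪x, TV x⟫_𝕜 := re_inner_pos_of_coerciveN NV hNVn hγV hcoerNV
  have h1 : NV (GV y) ≤ γV⁻¹ * ‖y‖ := by
    rw [rightInv_eq_greenK hposV hGV y]; exact weight_green_le hposV NV hNV hNVn hγV hcoerNV y
  calc N (GV y) ≤ (1 + δN) * NV (GV y) := hcmp _
    _ ≤ (1 + δN) * (γV⁻¹ * ‖y‖) := mul_le_mul_of_nonneg_left h1 (by linarith)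
    _ = (1 + δN) * γV⁻¹ * ‖y‖ := by ring

include hGU hGV hN hNn hγ' hΘ hcoerN hT hNVn hγV hcoerNV in
/-- **THE TWO TOGETHER**: `‖G_κ(V)y − G_κ(U)y‖ ≤ (Θ∕γ′)·((1 + δ_N)γ_V⁻¹)·‖y‖` from the coercivities of `T_U` in `N` and of `T_V` in `N_V`, the form defect `Θ`
in `N`, and the comparison `N ≤ (1 + δ_N)·N_V`. [folklore] [cite: Balaban1985BackgroundPropagators, Thm 3.4 p.400, (3.86) p.407, Thm 3.11 p.416] -/
theorem norm_rightInv_sub_rightInv_le_of_coercive (hNV : ∀ w, 0 ≤ NV w) {δN : ℝ} (hδN : 0 ≤ δN) (hcmp : ∀ g, N g ≤ (1 + δN) * NV g) (y : E) :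
    ‖GV y - GU y‖ ≤ Θ / γ' * ((1 + δN) * γV⁻¹) * ‖y‖ :=
  norm_rightInv_sub_rightInv_le hGU hGV N hN hNn hγ' hΘ hcoerN hT
    (fun y => row_of_coercive hGV N NV hNVn hγV hcoerNV hNV hδN hcmp y) NV hNVn hγV hcoerNV y

end Assembly

/-! ## §5 Non-vacuity of the scalar shapes -/

/-- The energy window is inhabited (`p_K = β = C_P = ρ = β_K = 0`, any `γ > 0`). [folklore] [cite: Balaban1985BackgroundPropagators, (3.49) p.399] -/
example {a γ : ℝ} (hγ : 0 < γ) : 3 / 4 * (0 : ℝ) + (21 + 3 * a) * 0 ^ 2 + 4 * 0 * 0 + 2 * 0 * 0 ^ 2 + 0 ≤ γ / 8 := by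
  norm_num; exact (div_pos hγ (by norm_num)).le

end Literature.MathematicalPhysics.QuantumFieldTheory.Balaban1983to89.B9Eq326ConjugatedDeltaAEnergyWeight

end
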